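import Mathlib
import HarnessLib
import Literature.Geometry.Lorentzian.KillingFlowIsometry
import Literature.Geometry.Lorentzian.CausalityOpennessProofs
import Literature.Geometry.Lorentzian.IPlusRegular

/-!
# Flow-invariance of a `T`-invariant sweep function and of its gradient; the uniform `ε` from
# compactness modulo `T` (crux `NonTrappingHawkingRigidity`, stmt-FinalStateConjecture-13896,
# line `Sketch`, stub S3 helper)

For a stationary black hole `𝓑` with a smooth global flow `θ` of `T = 𝓑.killing` preserving the
d.o.c. (`StationaryAFBlackHole.exists_stationary_flow`):

* `sweep_flow_invariant` — a function `f`, `C^∞` on the (open) d.o.c. with `df(T) = 0` there, is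
  constant along the flow: `f (φ_s p) = f p` (`p ∈ doc`);
* `sharp_mvfderiv_flow_invariant` — its gradient `grad f = ♯(df)` is then invariant under the
  isometries `φ_s`: `dφ_s (grad f (p)) = grad f (φ_s p)` (both pair with `dφ_s w` to `df_p(w)`);
* `stub_slabPatching_eps` (registered form) — **the uniform `ε`**: if `N` is an open,
  flow-invariant set containing the level `{f = c} ∩ doc`, `c ≥ c₀`, and the slab
  `{c₀ ≤ f ≤ c + 1} ∩ doc` lies in the `T`-orbit of a compact subset of the d.o.c., then
  `{c ≤ f < c + ε} ∩ doc ⊆ N` for some `ε > 0` (a sequence of bad points is moved by the flow into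
  the compact set, where it accumulates at a point of the level, inside the open `N`).
Everything is proved; no definitions.
-/

noncomputable section

-- D-0017: single-problem summit, `Summit.<S>.<S>.…` by design
set_option linter.dupNamespace false

namespace Summit.FinalStateConjecture.FinalStateConjecture.Theorems.NonTrappingHawkingRigidity.AzimuthalPartialAnalyticity.SlabPatching

open Set Filter Function Bundle Literature.Geometry.Lorentzian
open scoped Manifold ContDiff Topology

variable {𝓑 : StationaryAFBlackHole.{0}}

variable {θ : ℝ × 𝓑.carrier → 𝓑.carrier} {f : 𝓑.carrier → ℝ}

/-- **A `T`-invariant function is constant along the stationary flow on the d.o.c.**: if `f` is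
`C^∞` on the d.o.c. with `df(T) = 0` there and `θ` is a smooth flow of `T` preserving the d.o.c.,
then `f (θ (s, p)) = f p` for `p ∈ doc` (the derivative of `s ↦ f (θ (s, p))` is
`df(T) = 0`; no smoothness of `θ` is needed beyond the flow lines). [folklore] -/
theorem sweep_flow_invariant (hθ0 : ∀ p, θ (0, p) = p) (hθT : ∀ p, IsMIntegralCurve (fun t ↦ θ (t, p)) 𝓑.killing)
    (hdoc : ∀ p ∈ 𝓑.doc, ∀ s : ℝ, θ (s, p) ∈ 𝓑.doc)
    (hf : ContMDiffOn (𝓡 4) 𝓘(ℝ, ℝ) ∞ f 𝓑.doc)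
    (hfT : ∀ x ∈ 𝓑.doc, mfderiv (𝓡 4) 𝓘(ℝ, ℝ) f x (𝓑.killing x) = 0) :
    ∀ p ∈ 𝓑.doc, ∀ s : ℝ, f (θ (s, p)) = f p := by
  intro p hp s
  have hdoco : IsOpen 𝓑.doc :=
    𝓑.isOpen_doc LorentzianMetric.isOpen_chronologicalFuture_holds_of_boundaryless
      LorentzianMetric.isOpen_chronologicalPast_holds_of_boundaryless
  set h : ℝ → ℝ := fun s ↦ f (θ (s, p)) with hh
  have hderiv : ∀ s, HasDerivAt h 0 s := by
    intro s
    have hq : θ (s, p) ∈ 𝓑.doc := hdoc p hp s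
    have hfd : MDifferentiableAt (𝓡 4) 𝓘(ℝ, ℝ) f (θ (s, p)) :=
      ((hf _ hq).contMDiffAt (hdoco.mem_nhds hq)).mdifferentiableAt (by simp)
    have hc := hfd.hasMFDerivAt.comp s (hθT p s)
    have hzero : (mfderiv (𝓡 4) 𝓘(ℝ, ℝ) f (θ (s, p))).comp
        ((1 : ℝ →L[ℝ] ℝ).smulRight (𝓑.killing (θ (s, p)))) = 0 := by
      apply ContinuousLinearMap.ext_ring
      simp only [ContinuousLinearMap.comp_apply, ContinuousLinearMap.smulRight_apply,
        one_apply_eq_self, one_smul, _root_.zero_apply]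
      exact hfT _ hq
    have hc' : HasMFDerivAt 𝓘(ℝ, ℝ) 𝓘(ℝ, ℝ) h s (0 : ℝ →L[ℝ] ℝ) := hc.congr_mfderiv hzero
    have hF : HasFDerivAt h (0 : ℝ →L[ℝ] ℝ) s := hasMFDerivAt_iff_hasFDerivAt.1 hc'
    simpa using hF.hasDerivAt
  have hconst := is_const_of_deriv_eq_zero (fun s ↦ (hderiv s).differentiableAt)
    (fun s ↦ (hderiv s).deriv) s 0
  simp only [hh, hθ0] at hconst
  exact hconst

/-- **The gradient of a flow-invariant function is invariant under the isometric flow**: with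
`grad f = ♯(df)` (`PseudoRiemannianMetric.sharp` of `mvfderiv`), `dφ_s (grad f (p)) = grad f (φ_s p)`
for `p ∈ doc`. Indeed for `w ∈ T_p M`: `g(dφ_s grad f(p), dφ_s w) = g(grad f(p), w) = df_p(w)`
(isometry) and `g(grad f(φ_s p), dφ_s w) = df_{φ_s p}(dφ_s w) = d(f ∘ φ_s)_p(w) = df_p(w)`
(`f ∘ φ_s = f` on the open d.o.c.); `dφ_s` is onto and `g` nondegenerate. O'Neill 1983, Ch. 3,
Def. 3.9 ff. with Ch. 9, Prop. 9.23. [cite: ONeill1983, Ch. 9, Prop. 9.23] -/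
theorem sharp_mvfderiv_flow_invariant [𝓑.metric.HasLeviCivita]
    (hθ : ContMDiff (𝓘(ℝ, ℝ).prod (𝓡 4)) (𝓡 4) ∞ θ)
    (hθ0 : ∀ p, θ (0, p) = p) (hθadd : ∀ t s p, θ (t, θ (s, p)) = θ (t + s, p))
    (hiso : ∀ (s : ℝ) (p : 𝓑.carrier) (v w : TangentSpace (𝓡 4) p),
      𝓑.metric.val (θ (s, p)) (mfderiv (𝓡 4) (𝓡 4) (fun q ↦ θ (s, q)) p v)
        (mfderiv (𝓡 4) (𝓡 4) (fun q ↦ θ (s, q)) p w) = 𝓑.metric.val p v w)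
    (hdoc : ∀ p ∈ 𝓑.doc, ∀ s : ℝ, θ (s, p) ∈ 𝓑.doc)
    (hf : ContMDiffOn (𝓡 4) 𝓘(ℝ, ℝ) ∞ f 𝓑.doc)
    (hfinv : ∀ p ∈ 𝓑.doc, ∀ s : ℝ, f (θ (s, p)) = f p) :
    ∀ p ∈ 𝓑.doc, ∀ s : ℝ, mfderiv (𝓡 4) (𝓡 4) (fun q ↦ θ (s, q)) p
      (𝓑.metric.sharp p (mvfderiv (𝓡 4) f p).toLinearMap : TangentSpace (𝓡 4) p) =
      (𝓑.metric.sharp (θ (s, p)) (mvfderiv (𝓡 4) f (θ (s, p))).toLinearMap :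
        TangentSpace (𝓡 4) (θ (s, p))) := by
  intro p hp s
  have hdoco : IsOpen 𝓑.doc :=
    𝓑.isOpen_doc LorentzianMetric.isOpen_chronologicalFuture_holds_of_boundaryless
      LorentzianMetric.isOpen_chronologicalPast_holds_of_boundaryless
  have hθ2 : ContMDiff (𝓘(ℝ, ℝ).prod (𝓡 4)) (𝓡 4) 2 θ :=
    hθ.of_le (ENat.LEInfty.out : (2 : ℕ∞ω) ≤ ∞)
  have hq : θ (s, p) ∈ 𝓑.doc := hdoc p hp s
  have hsd : MDifferentiableAt (𝓡 4) (𝓡 4) (fun q ↦ θ (s, q)) p :=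
    PseudoRiemannianMetric.mdifferentiableAt_flow hθ2 s p
  have hfd : MDifferentiableAt (𝓡 4) 𝓘(ℝ, ℝ) f (θ (s, p)) :=
    ((hf _ hq).contMDiffAt (hdoco.mem_nhds hq)).mdifferentiableAt (by simp)
  -- `d(f ∘ φ_s)_p = df_p` since `f ∘ φ_s = f` near `p`
  have hev : (f ∘ fun q ↦ θ (s, q)) =ᶠ[𝓝 p] f := by
    filter_upwards [hdoco.mem_nhds hp] with x hx using hfinv x hx s
  have hchain : ∀ w : TangentSpace (𝓡 4) p,
      mfderiv (𝓡 4) 𝓘(ℝ, ℝ) f (θ (s, p)) (mfderiv (𝓡 4) (𝓡 4) (fun q ↦ θ (s, q)) p w) =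
        mfderiv (𝓡 4) 𝓘(ℝ, ℝ) f p w := by
    intro w
    have h := mfderiv_comp p hfd hsd
    rw [hev.mfderiv_eq] at h
    rw [h]
    rfl
  set A : TangentSpace (𝓡 4) (θ (s, p)) :=
    mfderiv (𝓡 4) (𝓡 4) (fun q ↦ θ (s, q)) p
        (𝓑.metric.sharp p (mvfderiv (𝓡 4) f p).toLinearMap : TangentSpace (𝓡 4) p) -
      (𝓑.metric.sharp (θ (s, p)) (mvfderiv (𝓡 4) f (θ (s, p))).toLinearMap :
        TangentSpace (𝓡 4) (θ (s, p))) with hA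
  -- `A` is orthogonal to the image of `dφ_s`
  have hH : ∀ w : TangentSpace (𝓡 4) p,
      𝓑.metric.val (θ (s, p)) A (mfderiv (𝓡 4) (𝓡 4) (fun q ↦ θ (s, q)) p w) = 0 := by
    intro w
    rw [hA, map_sub, _root_.sub_apply, hiso, PseudoRiemannianMetric.val_sharp_apply,
      PseudoRiemannianMetric.val_sharp_apply]
    show mvfderiv (𝓡 4) f p w - mvfderiv (𝓡 4) f (θ (s, p))
      (mfderiv (𝓡 4) (𝓡 4) (fun q ↦ θ (s, q)) p w) = 0
    have h := hchain w
    change mvfderiv (𝓡 4) f (θ (s, p)) (mfderiv (𝓡 4) (𝓡 4) (fun q ↦ θ (s, q)) p w) =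
      mvfderiv (𝓡 4) f p w at h
    rw [h, sub_self]
  -- `dφ_s` is onto
  have hsurj : ∀ u : TangentSpace (𝓡 4) (θ (s, p)),
      mfderiv (𝓡 4) (𝓡 4) (fun q ↦ θ (s, q)) p
        (mfderiv (𝓡 4) (𝓡 4) (fun q ↦ θ (-s, q)) (θ (s, p)) u) = u := by
    intro u
    have h := PseudoRiemannianMetric.mfderiv_flow_neg_apply_mfderiv_flow hθ2 hθ0 hθadd (-s)
      (θ (s, p)) u
    rw [neg_neg] at h
    rw [flow_neg_apply_flow hθ0 hθadd s p] at h
    exact h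
  have hA0 : A = 0 := by
    refine 𝓑.metric.nondegenerate (θ (s, p)) A fun u ↦ ?_
    have h := hH (mfderiv (𝓡 4) (𝓡 4) (fun q ↦ θ (-s, q)) (θ (s, p)) u)
    rw [hsurj u] at h
    exact h
  exact sub_eq_zero.1 hA0

/-- **Registered form (sub-goal `stub_slabPatching_eps` of stub S3 `stub_slabPatching`): the
uniform `ε` from compactness modulo `T`.** Let `θ` be a flow of `T = 𝓑.killing`
(`θ (0, ·) = id`, flow lines integral curves) preserving the d.o.c., `f` continuous on the d.o.c.
and constant along the flow there, `N` an open set invariant under the flow and containing the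
level `{f = c} ∩ doc`, and let the slab `{c₀ ≤ f ≤ c + 1} ∩ doc` (`c₀ ≤ c`) lie in the `T`-orbit of
a compact subset of the d.o.c. Then `{c ≤ f < c + ε} ∩ doc ⊆ N` for some `ε > 0`. Proof by
contradiction: bad points `xₙ` with `f xₙ ↓ c` are flow-images of points `sₙ` of the compact
set with the same `f`-values and `sₙ ∉ N`; a cluster point lies on the level, hence in the open
`N`. [folklore] -/
theorem stub_slabPatching_eps :
    ∀ (𝓑 : StationaryAFBlackHole.{0}) [𝓑.metric.HasLeviCivita],
      ∀ (θ : ℝ × 𝓑.carrier → 𝓑.carrier) (f : 𝓑.carrier → ℝ) (c₀ c : ℝ) (N : Set 𝓑.carrier),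
      (∀ p, θ (0, p) = p) → (∀ p, IsMIntegralCurve (fun t ↦ θ (t, p)) 𝓑.killing) →
      (∀ p ∈ 𝓑.doc, ∀ s : ℝ, θ (s, p) ∈ 𝓑.doc) →
      ContinuousOn f 𝓑.doc → (∀ p ∈ 𝓑.doc, ∀ s : ℝ, f (θ (s, p)) = f p) → c₀ ≤ c →
      (∃ S : Set 𝓑.carrier, IsCompact S ∧ S ⊆ 𝓑.doc ∧
        {x | x ∈ 𝓑.doc ∧ c₀ ≤ f x ∧ f x ≤ c + 1} ⊆ stationaryOrbit 𝓑.killing S) →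
      IsOpen N → (∀ p ∈ N, ∀ s : ℝ, θ (s, p) ∈ N) → (∀ q ∈ 𝓑.doc, f q = c → q ∈ N) →
      ∃ ε : ℝ, 0 < ε ∧ ∀ x ∈ 𝓑.doc, c ≤ f x → f x < c + ε → x ∈ N := by
  intro 𝓑 _ θ f c₀ c N hθ0 hθT hdoc hfc hfinv hc hslab hN hNinv hlevN
  obtain ⟨S, hS, hSdoc, hslab⟩ := hslab
  have hdoco : IsOpen 𝓑.doc :=
    𝓑.isOpen_doc LorentzianMetric.isOpen_chronologicalFuture_holds_of_boundaryless
      LorentzianMetric.isOpen_chronologicalPast_holds_of_boundaryless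
  have hT1 : ContMDiff (𝓡 4) (𝓡 4).tangent 1
      (fun x ↦ (⟨x, 𝓑.killing x⟩ : TangentBundle (𝓡 4) 𝓑.carrier)) :=
    𝓑.isStationaryKilling.isKillingField.contMDiff.of_le (by exact_mod_cast le_top)
  by_contra hcon
  push Not at hcon
  -- bad points `x n` with `c ≤ f (x n) < c + 1/(n+1)`, `x n ∉ N`
  have hbad : ∀ n : ℕ, ∃ x ∈ 𝓑.doc, c ≤ f x ∧ f x < c + 1 / ((n : ℝ) + 1) ∧ x ∉ N := by
    intro n
    obtain ⟨x, hx, hcx, hfx, hxN⟩ := hcon (1 / ((n : ℝ) + 1)) (by positivity)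
    exact ⟨x, hx, hcx, hfx, hxN⟩
  choose x hxdoc hcx hfx hxN using hbad
  -- moved into the compact set: `x n = θ (t n, s n)`, `s n ∈ S`, `f (s n) = f (x n)`, `s n ∉ N`
  have hsn : ∀ n, ∃ s ∈ S, f s = f (x n) ∧ s ∉ N := by
    intro n
    have hle : f (x n) ≤ c + 1 := by
      have h1 : 1 / ((n : ℝ) + 1) ≤ 1 := by
        rw [div_le_one (by positivity)]
        linarith [(Nat.cast_nonneg n : (0 : ℝ) ≤ n)]
      linarith [hfx n]
    obtain ⟨γ, hγ, hγ0, t, hγt⟩ := hslab ⟨hxdoc n, hc.trans (hcx n), hle⟩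
    have hflow : x n = θ (t, γ 0) := by
      rw [← hγt]
      exact eq_flow_of_isMIntegralCurve hT1 hθT hθ0 hγ t
    refine ⟨γ 0, hγ0, ?_, fun hmem ↦ hxN n ?_⟩
    · rw [hflow, hfinv _ (hSdoc hγ0) t]
    · rw [hflow]
      exact hNinv _ hmem t
  choose s hsS hfs hsN using hsn
  -- a cluster point `a ∈ S` of `s`, with `f a = c`
  obtain ⟨a, haS, φ, hφ, hlim⟩ := hS.tendsto_subseq hsS
  have hadoc : a ∈ 𝓑.doc := hSdoc haS
  have hfa : Tendsto (fun n ↦ f (s (φ n))) atTop (𝓝 (f a)) :=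
    ((hfc a hadoc).continuousAt (hdoco.mem_nhds hadoc)).tendsto.comp hlim
  have hfc' : Tendsto (fun n ↦ f (s (φ n))) atTop (𝓝 c) := by
    have hup : Tendsto (fun n : ℕ ↦ c + 1 / ((φ n : ℝ) + 1)) atTop (𝓝 c) := by
      have h1 : Tendsto (fun n : ℕ ↦ 1 / ((n : ℝ) + 1)) atTop (𝓝 0) :=
        tendsto_one_div_add_atTop_nhds_zero_nat
      have h2 := h1.comp hφ.tendsto_atTop
      simpa using tendsto_const_nhds.add h2
    refine tendsto_of_tendsto_of_tendsto_of_le_of_le tendsto_const_nhds hup (fun n ↦ ?_) fun n ↦ ?_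
    · show c ≤ f (s (φ n)); rw [hfs]; exact hcx _
    · show f (s (φ n)) ≤ c + 1 / ((φ n : ℝ) + 1); rw [hfs]; exact (hfx _).le
  have hfac : f a = c := tendsto_nhds_unique hfa hfc'
  -- `a ∈ N`, so eventually `s (φ n) ∈ N`: contradiction
  have haN : a ∈ N := hlevN a hadoc hfac
  have hev : ∀ᶠ n in atTop, s (φ n) ∈ N := hlim (hN.mem_nhds haN)
  obtain ⟨n, hn⟩ := hev.exists
  exact hsN _ hn

end Summit.FinalStateConjecture.FinalStateConjecture.Theorems.NonTrappingHawkingRigidity.AzimuthalPartialAnalyticity.SlabPatching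

end
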